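import Summits.SmoothPoincare4.SmoothPoincare4.Theses.InformationMetricHadamard
import Literature.Geometry.Manifold.CompleteFlow
import Literature.Geometry.Manifold.MaximalFlowContinuity

/-!
# Stub `stub_flowToRoundSphere` of line `core-distance-morse` — auxiliary file 1: the global flow
# of a `G`-short vector field (crux `InformationMetricHadamard.C0AhRecognition`, stmt-SmoothPoincare4-6015)

Let `(W⁵, G)` be a Riemannian manifold whose closed distance balls `{y | d_G(x, y) ≤ r}` are
compact, and `X` a smooth vector field with `G(X, X) ≤ 1`. Then the integral curves of `X` have
`G`-speed `≤ 1`, so `d_G(γ 0, γ t) ≤ |t|` (a priori bound), hence `X` is complete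
(`Literature.Geometry.Manifold.exists_isMIntegralCurve_of_apriori_isCompact`) and generates a
smooth global flow `θ : ℝ × W → W` (`exists_contMDiff_globalFlow_of_complete`), whose time-`t`
maps move points by at most `|t|` and transport `X` to itself (`dθ_t (X p) = X (θ_t p)`).

* `FlowToRoundSphere.edist_le_of_speed_le_one` — `d(γ a, γ b) ≤ b - a` for a `C¹` curve of speed `≤ 1`;
* `FlowToRoundSphere.exists_isMIntegralCurve_of_val_le_one` — completeness of `X`;
* `FlowToRoundSphere.mfderiv_flow_apply_eq` — flow invariance of `X`;
* `helper_flowToRoundSphere_1` — the registered helper packaging the global flow.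

Everything is proved (kind = proof); no definitions.
-/

noncomputable section

-- the prescribed namespace `Summit.<P>.<Sub>.…` duplicates `SmoothPoincare4` (P = Sub)
set_option linter.dupNamespace false

open scoped Manifold ContDiff Topology ENNReal NNReal
open Set Function Bundle Filter Manifold

namespace Summit.SmoothPoincare4.SmoothPoincare4.Cruxes.C0AhRecognition.CoreDistanceMorse

open Literature.Geometry.Lorentzian Literature.Geometry.Lorentzian.PseudoRiemannianMetric
  Literature.Geometry.Riemannian Literature.Geometry.Manifold

namespace FlowToRoundSphere

/-- The time-`t` map of a global flow is injective (its inverse is the time-`(-t)` map). [folklore] -/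
theorem flow_injective {W : Type} {θ : ℝ × W → W} (h0 : ∀ p : W, θ (0, p) = p)
    (hgrp : ∀ (t s : ℝ) (p : W), θ (t, θ (s, p)) = θ (t + s, p)) (t : ℝ) :
    Injective (fun q : W ↦ θ (t, q)) := by
  intro p q hpq
  have h : θ (-t, θ (t, p)) = θ (-t, θ (t, q)) := by rw [show θ (t, p) = θ (t, q) from hpq]
  rwa [hgrp, hgrp, neg_add_cancel, h0, h0] at h

variable {W : Type} [TopologicalSpace W] [ChartedSpace (EuclideanSpace ℝ (Fin 5)) W]
  [IsManifold (𝓡 5) ∞ W]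
  {G : PseudoRiemannianMetric (𝓡 5) ∞ (EuclideanSpace ℝ (Fin 5)) (TangentSpace (𝓡 5) : W → Type _)}

/-- **Slow curves are short**: a `C¹` curve `γ` on `[a, b]` with `G(γ', γ') ≤ 1` has
`d_G(γ a, γ b) ≤ b - a` (the distance is at most the length `∫_a^b |γ'| ≤ b - a`). [folklore] -/
theorem edist_le_of_speed_le_one (hG : G.IsRiemannian) {γ : ℝ → W} {a b : ℝ} (hab : a ≤ b)
    (hγ : ContMDiffOn 𝓘(ℝ, ℝ) (𝓡 5) 1 γ (Icc a b))
    (hv : ∀ t ∈ Icc a b,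
      G.val (γ t) (mfderiv 𝓘(ℝ, ℝ) (𝓡 5) γ t 1) (mfderiv 𝓘(ℝ, ℝ) (𝓡 5) γ t 1) ≤ 1) :
    G.edist hG (γ a) (γ b) ≤ ENNReal.ofReal (b - a) := by
  refine (G.edist_le_length hG hab hγ).trans ?_
  rw [G.length_eq_lintegral hG]
  calc ∫⁻ t in Icc a b, ENNReal.ofReal (Real.sqrt
          (G.val (γ t) (mfderiv 𝓘(ℝ, ℝ) (𝓡 5) γ t 1) (mfderiv 𝓘(ℝ, ℝ) (𝓡 5) γ t 1)))
        ≤ ∫⁻ _ in Icc a b, 1 := by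
          refine MeasureTheory.setLIntegral_mono measurable_const fun t ht ↦ ?_
          rw [← ENNReal.ofReal_one]
          refine ENNReal.ofReal_le_ofReal ?_
          calc Real.sqrt _ ≤ Real.sqrt 1 := Real.sqrt_le_sqrt (hv t ht)
            _ = 1 := Real.sqrt_one
    _ = ENNReal.ofReal (b - a) := by
          rw [MeasureTheory.setLIntegral_const, Real.volume_Icc, one_mul]

/-- **Integral curves of a `G`-short field are slow**: if `γ` is `C¹` on `[a, b]` with
`γ' = X ∘ γ` there and `G(X, X) ≤ 1`, then `d_G(γ a, γ b) ≤ b - a`. [folklore] -/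
theorem edist_le_of_hasMFDerivAt (hG : G.IsRiemannian) {X : Π y : W, TangentSpace (𝓡 5) y}
    (hXle : ∀ y : W, G.val y (X y) (X y) ≤ 1) {γ : ℝ → W} {a b : ℝ} (hab : a ≤ b)
    (hγ : ContMDiffOn 𝓘(ℝ, ℝ) (𝓡 5) 1 γ (Icc a b))
    (hγ' : ∀ t ∈ Icc a b,
      HasMFDerivAt 𝓘(ℝ, ℝ) (𝓡 5) γ t ((1 : ℝ →L[ℝ] ℝ).smulRight (X (γ t)))) :
    G.edist hG (γ a) (γ b) ≤ ENNReal.ofReal (b - a) := by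
  refine edist_le_of_speed_le_one hG hab hγ fun t ht ↦ ?_
  have h : mfderiv 𝓘(ℝ, ℝ) (𝓡 5) γ t 1 = X (γ t) := by
    rw [(hγ' t ht).mfderiv]
    exact one_smul ℝ (X (γ t))
  rw [h]
  exact hXle _

/-- **A `G`-short smooth field on a manifold with compact distance balls is complete**: through
every point there is an integral curve of `X` defined on all of `ℝ`. Any integral curve on an
open interval through `x` is a restriction of the maximal one, which is smooth
(`exists_maximalFlow_contMDiffOn`), hence has speed `≤ 1` and stays in the compact ball
`{d_G(x, ·) ≤ T}` for `|t| ≤ T`; a priori bounds give completeness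
(`exists_isMIntegralCurve_of_apriori_isCompact`). [cite: LeeSmoothManifolds2013, Thm. 9.12] -/
theorem exists_isMIntegralCurve_of_val_le_one [T2Space W] (hG : G.IsRiemannian)
    (hcpt : ∀ (x : W) (r : NNReal), IsCompact {y : W | G.edist hG x y ≤ r})
    {X : Π y : W, TangentSpace (𝓡 5) y}
    (hX : ContMDiff (𝓡 5) (𝓡 5).tangent ∞ (fun y ↦ (⟨y, X y⟩ : TangentBundle (𝓡 5) W)))
    (hXle : ∀ y : W, G.val y (X y) (X y) ≤ 1) (x : W) :
    ∃ γ : ℝ → W, γ 0 = x ∧ IsMIntegralCurve γ X := by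
  obtain ⟨Θ, D, hΘ, -, -, h𝒟s⟩ :=
    exists_maximalFlow_contMDiffOn (I := 𝓡 5) (M := W) (n := ⊤) hX le_top
  refine exists_isMIntegralCurve_of_apriori_isCompact hX le_top (fun x T ↦ ?_) x
  refine ⟨{y | G.edist hG x y ≤ Real.toNNReal T}, hcpt x _,
    fun γ J hJo hJc h0J hγ0 hγ t htJ htT ↦ ?_⟩
  -- `γ` agrees with the smooth maximal curve `Θ x` on `J ⊆ D x`
  obtain ⟨hJD, hγΘ⟩ := (hΘ x).2.2.2.2.2 γ J hJo hJc 0 h0J (hΘ x).2.2.1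
    (by rw [hγ0, (hΘ x).2.2.2.1]) hγ
  have hΘs : ContMDiffOn 𝓘(ℝ, ℝ) (𝓡 5) ∞ (Θ x) (D x) :=
    h𝒟s.comp (contMDiffOn_const.prodMk contMDiffOn_id) fun t ht ↦ ht
  have hγs : ContMDiffOn 𝓘(ℝ, ℝ) (𝓡 5) 1 γ J :=
    ((hΘs.mono hJD).of_le (by exact_mod_cast le_top)).congr hγΘ
  have hγd : ∀ s ∈ J, HasMFDerivAt 𝓘(ℝ, ℝ) (𝓡 5) γ s ((1 : ℝ →L[ℝ] ℝ).smulRight (X (γ s))) :=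
    fun s hs ↦ (hγ s hs).hasMFDerivAt (hJo.mem_nhds hs)
  show G.edist hG x (γ t) ≤ ENNReal.ofReal T
  refine le_trans ?_ (ENNReal.ofReal_le_ofReal htT)
  rcases le_total 0 t with ht0 | ht0
  · have hsub : Icc 0 t ⊆ J := hJc.out h0J htJ
    have h := edist_le_of_hasMFDerivAt hG hXle ht0 (hγs.mono hsub) fun s hs ↦ hγd s (hsub hs)
    rw [hγ0, sub_zero] at h
    rwa [abs_of_nonneg ht0]
  · have hsub : Icc t 0 ⊆ J := hJc.out htJ h0J
    have h := edist_le_of_hasMFDerivAt hG hXle ht0 (hγs.mono hsub) fun s hs ↦ hγd s (hsub hs)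
    rw [hγ0, zero_sub, G.edist_comm hG] at h
    rwa [abs_of_nonpos ht0]

/-- **Flow lines of a `G`-short field move points slowly**: `d_G(p, θ_t p) ≤ |t|` for the smooth
global flow `θ` of `X`, `G(X, X) ≤ 1`. [folklore] -/
theorem edist_flow_le (hG : G.IsRiemannian) {X : Π y : W, TangentSpace (𝓡 5) y}
    (hXle : ∀ y : W, G.val y (X y) (X y) ≤ 1) {θ : ℝ × W → W}
    (hθ : ContMDiff (𝓘(ℝ, ℝ).prod (𝓡 5)) (𝓡 5) ∞ θ) (h0 : ∀ p : W, θ (0, p) = p)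
    (hcurve : ∀ p : W, IsMIntegralCurve (fun t : ℝ ↦ θ (t, p)) X) (t : ℝ) (p : W) :
    G.edist hG p (θ (t, p)) ≤ ENNReal.ofReal |t| := by
  have hs : ContMDiff 𝓘(ℝ, ℝ) (𝓡 5) 1 (fun s : ℝ ↦ θ (s, p)) :=
    (hθ.comp (contMDiff_id.prodMk contMDiff_const)).of_le (by exact_mod_cast le_top)
  rcases le_total 0 t with ht0 | ht0
  · have h := edist_le_of_hasMFDerivAt hG hXle ht0 hs.contMDiffOn fun s _ ↦ hcurve p s
    rw [h0, sub_zero] at h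
    rwa [abs_of_nonneg ht0]
  · have h := edist_le_of_hasMFDerivAt hG hXle ht0 hs.contMDiffOn fun s _ ↦ hcurve p s
    rw [h0, zero_sub, G.edist_comm hG] at h
    rwa [abs_of_nonpos ht0]

omit [IsManifold (𝓡 5) ∞ W] in
/-- **Flow invariance of the generating field**: `dθ_t (X p) = X (θ_t p)` for a smooth global flow
`θ` of `X` (differentiate `θ_t (θ_s p) = θ_{s + t} p` in `s` at `0`). [cite: LeeSmoothManifolds2013, Prop. 9.13] -/
theorem mfderiv_flow_apply_eq [IsManifold (𝓡 5) 1 W] {X : Π y : W, TangentSpace (𝓡 5) y}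
    {θ : ℝ × W → W} (hθt : ∀ t : ℝ, ContMDiff (𝓡 5) (𝓡 5) 1 (fun q : W ↦ θ (t, q)))
    (h0 : ∀ p : W, θ (0, p) = p)
    (hgrp : ∀ (t s : ℝ) (p : W), θ (t, θ (s, p)) = θ (t + s, p))
    (hcurve : ∀ p : W, IsMIntegralCurve (fun t : ℝ ↦ θ (t, p)) X) (t : ℝ) (p : W) :
    mfderiv (𝓡 5) (𝓡 5) (fun q : W ↦ θ (t, q)) p (X p) = X (θ (t, p)) := by
  have h1 : HasMFDerivAt 𝓘(ℝ, ℝ) (𝓡 5) ((fun q : W ↦ θ (t, q)) ∘ (fun s : ℝ ↦ θ (s, p))) 0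
      ((mfderiv (𝓡 5) (𝓡 5) (fun q : W ↦ θ (t, q)) (θ (0, p))).comp
        ((1 : ℝ →L[ℝ] ℝ).smulRight (X (θ (0, p))))) :=
    HasMFDerivAt.comp 0 ((hθt t).mdifferentiableAt one_ne_zero).hasMFDerivAt (hcurve p 0)
  have h2 : HasMFDerivAt 𝓘(ℝ, ℝ) (𝓡 5) ((fun s : ℝ ↦ θ (s, p)) ∘ (· + t)) 0
      ((1 : ℝ →L[ℝ] ℝ).smulRight (X (((fun s : ℝ ↦ θ (s, p)) ∘ (· + t)) 0))) :=
    (hcurve p).comp_add t 0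
  have heq : ((fun q : W ↦ θ (t, q)) ∘ (fun s : ℝ ↦ θ (s, p))) =
      ((fun s : ℝ ↦ θ (s, p)) ∘ (· + t)) := by
    funext s
    simp only [Function.comp_apply, hgrp, add_comm]
  rw [heq] at h1
  have h : mfderiv (𝓡 5) (𝓡 5) (fun q : W ↦ θ (t, q)) (θ (0, p)) ((1 : ℝ) • X (θ (0, p))) =
      (1 : ℝ) • X (θ (0 + t, p)) :=
    DFunLike.congr_fun (hasMFDerivAt_unique h1 h2) 1
  rw [one_smul, one_smul, h0, zero_add] at h
  exact h

omit [IsManifold (𝓡 5) ∞ W] in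
/-- The differential of the time-`t` map of a smooth global flow is injective (its inverse is the
differential of the time-`(-t)` map). [folklore] -/
theorem mfderiv_flow_injective [IsManifold (𝓡 5) 1 W] {θ : ℝ × W → W}
    (hθt : ∀ t : ℝ, ContMDiff (𝓡 5) (𝓡 5) 1 (fun q : W ↦ θ (t, q)))
    (h0 : ∀ p : W, θ (0, p) = p)
    (hgrp : ∀ (t s : ℝ) (p : W), θ (t, θ (s, p)) = θ (t + s, p)) (t : ℝ) (p : W) :
    Injective (mfderiv (𝓡 5) (𝓡 5) (fun q : W ↦ θ (t, q)) p) := by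
  have hcomp := mfderiv_comp p ((hθt (-t)).mdifferentiableAt one_ne_zero)
    ((hθt t).mdifferentiableAt one_ne_zero)
  have hid : ((fun q : W ↦ θ (-t, q)) ∘ fun q : W ↦ θ (t, q)) = id := by
    funext q
    simp only [Function.comp_apply, id_eq, hgrp, neg_add_cancel, h0]
  rw [hid, mfderiv_id] at hcomp
  intro v w hvw
  have hv : v = mfderiv (𝓡 5) (𝓡 5) (fun q : W ↦ θ (-t, q)) (θ (t, p))
      (mfderiv (𝓡 5) (𝓡 5) (fun q : W ↦ θ (t, q)) p v) := DFunLike.congr_fun hcomp v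
  have hw : w = mfderiv (𝓡 5) (𝓡 5) (fun q : W ↦ θ (-t, q)) (θ (t, p))
      (mfderiv (𝓡 5) (𝓡 5) (fun q : W ↦ θ (t, q)) p w) := DFunLike.congr_fun hcomp w
  rw [hv, hw, hvw]

end FlowToRoundSphere

open FlowToRoundSphere in
/-- **Helper 1 for stub E3 (`flowToRoundSphere`): the global flow of a `G`-short field.** On a
Riemannian `5`-manifold `(W, G)` with compact closed distance balls, a smooth field `X` with
`G(X, X) ≤ 1` generates a smooth global flow `θ : ℝ × W → W` (`θ_0 = id`,
`θ_t ∘ θ_s = θ_{t+s}`, `t ↦ θ_t p` the integral curves), with `d_G(p, θ_t p) ≤ |t|` and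
`dθ_t (X p) = X (θ_t p)`. [cite: LeeSmoothManifolds2013, Thm. 9.12] -/
theorem helper_flowToRoundSphere_1
    (W : Type) [TopologicalSpace W] [T2Space W]
    [ChartedSpace (EuclideanSpace ℝ (Fin 5)) W] [IsManifold (𝓡 5) ∞ W]
    (G : PseudoRiemannianMetric (𝓡 5) ∞ (EuclideanSpace ℝ (Fin 5)) (TangentSpace (𝓡 5) : W → Type _))
    (hG : G.IsRiemannian)
    (hcpt : ∀ (x : W) (r : NNReal), IsCompact {y : W | G.edist hG x y ≤ r})
    (X : Π y : W, TangentSpace (𝓡 5) y)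
    (hX : ContMDiff (𝓡 5) (𝓡 5).tangent ∞ (fun y ↦ (⟨y, X y⟩ : TangentBundle (𝓡 5) W)))
    (hXle : ∀ y : W, G.val y (X y) (X y) ≤ 1) :
    ∃ θ : ℝ × W → W, ContMDiff (𝓘(ℝ, ℝ).prod (𝓡 5)) (𝓡 5) ∞ θ ∧ (∀ p : W, θ (0, p) = p) ∧
      (∀ (t s : ℝ) (p : W), θ (t, θ (s, p)) = θ (t + s, p)) ∧
      (∀ p : W, IsMIntegralCurve (fun t : ℝ ↦ θ (t, p)) X) ∧
      (∀ (t : ℝ) (p : W), G.edist hG p (θ (t, p)) ≤ ENNReal.ofReal |t|) ∧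
      (∀ t : ℝ, Injective (fun q : W ↦ θ (t, q))) ∧
      (∀ (t : ℝ) (p : W), Injective (mfderiv (𝓡 5) (𝓡 5) (fun q : W ↦ θ (t, q)) p)) ∧
      (∀ (t : ℝ) (p : W), mfderiv (𝓡 5) (𝓡 5) (fun q : W ↦ θ (t, q)) p (X p) = X (θ (t, p))) := by
  obtain ⟨θ, hθ, h0, hgrp, hcurve⟩ := exists_contMDiff_globalFlow_of_complete hX le_top
    (exists_isMIntegralCurve_of_val_le_one hG hcpt hX hXle)
  have hθt : ∀ t : ℝ, ContMDiff (𝓡 5) (𝓡 5) 1 (fun q : W ↦ θ (t, q)) := fun t ↦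
    (hθ.comp (contMDiff_const.prodMk contMDiff_id)).of_le (by exact_mod_cast le_top)
  exact ⟨θ, hθ, h0, hgrp, hcurve, edist_flow_le hG hXle hθ h0 hcurve,
    flow_injective h0 hgrp, mfderiv_flow_injective hθt h0 hgrp,
    mfderiv_flow_apply_eq hθt h0 hgrp hcurve⟩

end Summit.SmoothPoincare4.SmoothPoincare4.Cruxes.C0AhRecognition.CoreDistanceMorse

end
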